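import Summits.CriticalPhenomena.CardyFormulaZ2.Theses.CardySelfRefinement
import Summits.CriticalPhenomena.CardyFormulaZ2.Theorems.CardySelfRefinementExactEndpoints
import Summits.CriticalPhenomena.CardyFormulaZ2.Theorems.CardySelfRefinementLagsToInvariance
import Summits.CriticalPhenomena.CardyFormulaZ2.Theorems.CardySelfRefinementTwoLagsAllLags
import HarnessLib

/-!
# `ScaleInvariantLimits` from the route's engine items (crux stmt-CriticalPhenomena-10265)

The crux `ScaleInvariantLimits` (dilation invariance of every subsequential quad-crossing limit of
critical bond-`ℤ²` percolation) is the TARGET of route `CardySelfRefinement`; the gate classes it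
as an underived hypothesis of the deciding theorem `closes` (auto-crux), although the route derives
it: `RussoDrift` turns the three engine cruxes into the lattice lags at `k = 2, 3`, and the PROVED
items `ExactEndpoints` (`exactEndpoints_proof`), `LagsToInvariance` (`lagsToInvariance_proof`) and
`TwoLagsAllLags` (`twoLagsAllLags_proof`) carry the lags to the crux.  This file records that
reduction as one importable theorem whose hypotheses are EXACTLY the four open engine items
(stmt-CriticalPhenomena-10266 `TrivialSectorRate`, -10267 `CriticalPathRSW`,
-10269 `GradientComparability`, -10271 `RussoDrift`), so that the crux's dependency on the engine is
visible by name (helper `--supports` the crux; it does not close it).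

References: Beffara 2008 (arXiv:0708.3908) §5 (interpolation template); Schramm–Smirnov 2011
(quad-crossing space); the route file `Theses/CardySelfRefinement.lean`.
-/

namespace Summit.CriticalPhenomena.CardyFormulaZ2.Theorems

open Summit.CriticalPhenomena.CardyFormulaZ2.Theses.CardySelfRefinement

/-- **The crux from the four open engine items.**  `TrivialSectorRate`, `CriticalPathRSW`,
`GradientComparability` and `RussoDrift` (items 10266, 10267, 10269, 10271 of route
`CardySelfRefinement`) imply `ScaleInvariantLimits`: `RussoDrift` applied to the three cruxes is the
lattice-lag statement, `lagsToInvariance_proof exactEndpoints_proof` turns it into `S₂`- and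
`S₃`-invariance of every subsequential limit, and `twoLagsAllLags_proof` into invariance under every
`S_t`, `t > 0`. -/
theorem scaleInvariantLimits_of_engine (hTSR : TrivialSectorRate) (hCP : CriticalPathRSW)
    (hGC : GradientComparability) (hRD : RussoDrift) : ScaleInvariantLimits :=
  twoLagsAllLags_proof (lagsToInvariance_proof exactEndpoints_proof (hRD hTSR hCP hGC))

end Summit.CriticalPhenomena.CardyFormulaZ2.Theorems
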